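import Summits.QuantumFields.BalabanUV.T4Continuum.Support.ShellMeasureLandauWilsonSquares
import Summits.QuantumFields.BalabanUV.T4Continuum.Support.ShellMeasureLandauPinnedField
import Summits.QuantumFields.BalabanUV.T4Continuum.Support.ShellMeasureRayTermsPinned

/-!
# `T4Continuum.ShellMeasureLandauWilsonSquaresPinned` — row S74, file 2: THE FAR WEIGHT PLAQUETTES, PINNED
# (file 1's Wilson square terms with the letter bounds read through S69's pinned reading `π𝒴` —
# `‖ℓ Y‖ ≤ κ_w p·‖π𝒴 Y‖`, curl `≤ κ_c p·‖π𝒴 Y‖`, `‖π𝒴 Z_V(z)‖ ≤ z_pin` (leaf-07-g6's S70 (iv)) — and the located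
# budget `Σ_p |β|(d_p + S_p)S_p ≤ |β|(d̄ + S̄)S̄·#B₀·m₀·K₁` on the torus: NO `#P_w`, NO `T`)
(cell `pub-balaban`, sub-cell `t4`, spine estimate NE7c (node U5b); NE7c ROUND-2 crew, unit
`b2b-balaban-t4-ne7c-formalise-leaf-09` gen 11; owner table `t4/b2b-balaban-t4-ne7c-p1/LEAVES-NE7c-P1.md` row S74
«THE WILSON PART AS SQUARE TERMS IN END-II» (journal CLAIM l.16793; file 1 = p225819); ADDITIVE — imports file 1
`ShellMeasureLandauWilsonSquares` (`hE_of_wilsonPlaquettes`), leaf-07-g6's `ShellMeasureLandauPinnedField`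
(p225019: `norm_sub_landauField_chart_le`, the pinned size `z_pin` of the exponent field on the chart ball) and this
lineage's S71 `ShellMeasureRayTermsPinned` (S69 `sum_exp_neg_pinDist_le`, `pinDist`) ONLY; [folklore]; 0 `def`,
0 `def … : Prop`, 0 sorry, 0 citations)

HONEST FRAMING.  Finite four-torus programme, rung (B)+1 only — NOT infinite volume, NOT a mass gap, NOT the Clay
problem, NOT summit progress; (B), `BetaPertHyp`, (B^μ) not consumed.  NE7c (`T4IndicatorShell.ShellWeightBound`) is
NOT PRINTED in [Balaban 1983–89] and NOT PROVED; «NE7c ⇐ the named binders» (trigger c3).  Nothing printed is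
asserted; no estimate of Bałaban's is discharged; a RE-WIRING of OUR END-II's Wilson slot on OUR side.  HONEST
DEPENDENCY (cell): continuum YM on T⁴ ⇐ BetaPertH ∧ nine spine estimates (0/9 proved); BetaPertH ⇐ (D1) ∧ (D4) ∧
CAP+tail; G-an2-4 gates asym, D1 and NE2/3/4.
THE POINT (file 1's (W6); owner row S74 «far plaquettes through S69 (B), summed by S71»).  File 1 bounds the
letters of plaquette `p` by `κ_w p·‖Z‖`, the curl by `κ_c p·‖Z‖`, FLAT; for the far plaquettes the smallness is in WHERE
the read-out looks: in S69's pinned reading `κ_w p`, `κ_c p` carry `e^{−δ′ϖ(p)}` (S69 (B) `norm_readOut_le_of_blind`)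
and the field's pinned size on the chart ball is leaf-07-g6's `z_pin` (S70 (iv)).
* §1 scalar bookkeeping (`expTail₂(λt) ≤ λ·expTail₂ t`; the Stokes size and the square cost under a pin; the LOCATED
  BUDGET `Σ_p |β|(d_p + S_p)S_p ≤ |β|(d̄ + S̄)S̄·Σ_p e_p`, on the torus `≤ |β|(d̄ + S̄)S̄·#B₀·m₀·K₁ d δ′` — NO `#P_w`).
* §2 **`hE_landau_wilsonSquares_of_discBounds`** — file 1's §4 with the letter ∕ curl bounds as BINDERS ON THE CURVE.
* §3 **`hE_landau_wilsonSquares_pinned`** — THE PINNED INSTANCE (readings `π𝒴, π𝒴′, π𝒳, πℬ`, leaf-07's pinned chain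
  binders VERBATIM, PINNED read-out binders `‖ℓ Y‖ ≤ κ_w p‖π𝒴 Y‖`, `‖Σ_ℓ ℓ Y‖ ≤ κ_c p‖π𝒴 Y‖`; `S_p` in `z_pin`).
* §4 `hsum_of_located` — §3's budget binder from located constants; §5 (v1.1) the η-display of N-ne7cp1-g31-3.
DISPLAYED, NOT DISCHARGED (c2): every chain binder, flat and pinned; `κ_w p`, `κ_c p`, `κ̄`, `δ′`, `m₀`; the skew∕real
structure; the reading itself (S69's `WSup`, inhabited by S70 ∕ leaf-08's `DCf`).  NE7c NOT PROVED; spine 0∕9.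
-/

noncomputable section
open Set Metric NormedSpace
open scoped Matrix
namespace Summit.QuantumFields.BalabanUV.T4Continuum.ShellMeasureLandauWilsonSquaresPinned

open Literature.MathematicalPhysics.QuantumFieldTheory.Balaban1983to89
open B11Prop6Scheme (Prop4Hyp)
open B12Decay510Window (K₁)
open TreeLengthTorus (TPt)
open T4ShellMeasurePlaquette (expTail₂ expTail₂_nonneg expTail₂_mono)
open Summit.QuantumFields.BalabanUV.T4Continuum.ShellMeasureWilsonWords (wordExp)
open Summit.QuantumFields.BalabanUV.T4Continuum.ShellMeasureLandauExponent (currentData_zero)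
open Summit.QuantumFields.BalabanUV.T4Continuum.ShellMeasureLandauHolonomy (solAt landauExp)
open Summit.QuantumFields.BalabanUV.T4Continuum.ShellMeasureLandauHolonomyChart (holOf holOf_apply cplx
  ofReal_smul_cplx rayData_chart smul_cplx_mem_ball)
open Summit.QuantumFields.BalabanUV.T4Continuum.ShellMeasureLandauHolonomyWeight (landauCurve_along)
open Summit.QuantumFields.BalabanUV.T4Continuum.ShellMeasureLandauHolonomyReal (landauField_mem_real)
open Summit.QuantumFields.BalabanUV.T4Continuum.ShellMeasureLandauPinnedFixedPoint (solAt_zero_zero landauExp_zero)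
open Summit.QuantumFields.BalabanUV.T4Continuum.ShellMeasureLandauPinnedField (norm_sub_landauField_chart_le)
open Summit.QuantumFields.BalabanUV.T4Continuum.ShellMeasureLandauWilsonSquares (hE_of_wilsonPlaquettes)
open Summit.QuantumFields.BalabanUV.T4Continuum.ShellMeasurePinnedNorm (pinDist sum_exp_neg_pinDist_le)
open Summit.QuantumFields.BalabanUV.T4Continuum.ShellMeasureRayTermsPinned (locatedSum_le_of_uniform)

/-! ## §1 Scalar bookkeeping: the Stokes size under a pin, the located square budget -/

section Scalar

/-- `expTail₂ (λ t) ≤ λ·expTail₂ t` for `0 ≤ λ ≤ 1` (convexity of `exp` between `0` and `t`; `expTail₂ 0 = 0`).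
[folklore] -/
theorem expTail₂_mul_le {c t : ℝ} (hc0 : 0 ≤ c) (hc1 : c ≤ 1) : expTail₂ (c * t) ≤ c * expTail₂ t := by
  have h := convexOn_exp.2 (mem_univ t) (mem_univ 0) hc0 (sub_nonneg.2 hc1) (add_sub_cancel c 1)
  simp only [smul_eq_mul, mul_zero, add_zero, Real.exp_zero, mul_one] at h
  unfold expTail₂
  nlinarith [h]

/-- THE STOKES SIZE UNDER A PIN: `κ_c ≤ κ̄_c·e`, `κ_w ≤ κ̄_w·e`, `0 ≤ e ≤ 1`, `0 ≤ z` ⟹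
`κ_c z + expTail₂(m(κ_w z)) ≤ e·(κ̄_c z + expTail₂(m(κ̄_w z)))`. [folklore] -/
theorem stokesSize_le_of_pinned {κc κw κc' κw' e z : ℝ} {m : ℕ} (he0 : 0 ≤ e) (he1 : e ≤ 1) (hz : 0 ≤ z)
    (hκw : 0 ≤ κw) (hc : κc ≤ κc' * e) (hw : κw ≤ κw' * e) :
    κc * z + expTail₂ (m * (κw * z)) ≤ e * (κc' * z + expTail₂ (m * (κw' * z))) := by
  have h1 : κc * z ≤ e * (κc' * z) := by nlinarith
  have h2 : expTail₂ (m * (κw * z)) ≤ e * expTail₂ (m * (κw' * z)) := by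
    have hle : (m : ℝ) * (κw * z) ≤ e * (m * (κw' * z)) :=
      calc (m : ℝ) * (κw * z) ≤ m * (κw' * e * z) :=
            mul_le_mul_of_nonneg_left (mul_le_mul_of_nonneg_right hw hz) (Nat.cast_nonneg m)
        _ = e * (m * (κw' * z)) := by ring
    exact (expTail₂_mono (by positivity) hle).trans (expTail₂_mul_le he0 he1)
  rw [mul_add]
  exact add_le_add h1 h2

/-- THE SQUARE COST UNDER A PIN: `0 ≤ S ≤ e·S̄`, `d ≤ d̄`, `0 ≤ d̄`, `e ≤ 1`, `0 ≤ S̄` ⟹ `(d + S)S ≤ (d̄ + S̄)S̄·e`.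
[folklore] -/
theorem squareCost_le_of_pinned {d d' S S' e : ℝ} (he1 : e ≤ 1) (hS0 : 0 ≤ S) (hS' : 0 ≤ S') (hd' : 0 ≤ d')
    (hS : S ≤ e * S') (hd : d ≤ d') : (d + S) * S ≤ (d' + S') * S' * e := by
  have hSS' : S ≤ S' := hS.trans (by nlinarith)
  have hd0 : d + S ≤ d' + S' := add_le_add hd hSS'
  have hdS : 0 ≤ d' + S' := add_nonneg hd' hS'
  calc (d + S) * S ≤ (d' + S') * S := mul_le_mul_of_nonneg_right hd0 hS0
    _ ≤ (d' + S') * (e * S') := mul_le_mul_of_nonneg_left hS hdS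
    _ = (d' + S') * S' * e := by ring

/-- **THE LOCATED SQUARE BUDGET**: per plaquette `κ_c p ≤ κ̄_c e_p`, `0 ≤ κ_w p ≤ κ̄_w e_p`, `0 ≤ κ_c p`, `d_p ≤ d̄`,
`0 ≤ e_p ≤ 1`, `0 ≤ z`, `0 ≤ κ̄_c`, `0 ≤ d̄` ⟹ `Σ_{p∈P} |β|(d_p + S_p)S_p ≤ |β|(d̄ + S̄)S̄·Σ_{p∈P} e_p`,
`S_p = κ_c p z + expTail₂(m κ_w p z)`, `S̄ = κ̄_c z + expTail₂(m κ̄_w z)`. [folklore] -/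
theorem locatedSquareBudget_le {𝔭 : Type*} (P : Finset 𝔭) {κc κw d e : 𝔭 → ℝ} {κc' κw' d' z β : ℝ} {m : ℕ}
    (he0 : ∀ p ∈ P, 0 ≤ e p) (he1 : ∀ p ∈ P, e p ≤ 1) (hz : 0 ≤ z) (hκc' : 0 ≤ κc') (hd' : 0 ≤ d')
    (hκc0 : ∀ p ∈ P, 0 ≤ κc p) (hκw0 : ∀ p ∈ P, 0 ≤ κw p)
    (hκc : ∀ p ∈ P, κc p ≤ κc' * e p) (hκw : ∀ p ∈ P, κw p ≤ κw' * e p) (hd : ∀ p ∈ P, d p ≤ d') :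
    ∑ p ∈ P, |β| * (d p + (κc p * z + expTail₂ (m * (κw p * z)))) * (κc p * z + expTail₂ (m * (κw p * z))) ≤
      |β| * ((d' + (κc' * z + expTail₂ (m * (κw' * z)))) * (κc' * z + expTail₂ (m * (κw' * z)))) *
        ∑ p ∈ P, e p := by
  rw [Finset.mul_sum]
  refine Finset.sum_le_sum fun p hp => ?_
  have hS' : 0 ≤ κc' * z + expTail₂ (m * (κw' * z)) := add_nonneg (mul_nonneg hκc' hz) (expTail₂_nonneg _)
  have h := squareCost_le_of_pinned (he1 p hp) (add_nonneg (mul_nonneg (hκc0 p hp) hz) (expTail₂_nonneg _)) hS' hd'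
    (stokesSize_le_of_pinned (he0 p hp) (he1 p hp) hz (hκw0 p hp) (hκc p hp) (hκw p hp)) (hd p hp)
  have := mul_le_mul_of_nonneg_left h (abs_nonneg β)
  simpa [mul_assoc] using this

variable {dT T : ℕ} [NeZero T]

/-- **… ON THE TORUS, BY MULTIPLICITY**: weight plaquettes placed by `pos : 𝔭 → (ℤ∕Tℤ)^{d}` with at most `m₀` per site,
`e_p = e^{−δ′·pinDist B₀ (pos p)}`, `δ′ > 0` ⟹ `Σ_p |β|(d_p + S_p)S_p ≤ |β|(d̄ + S̄)S̄·(#B₀·m₀·K₁ d δ′)` — NO `#𝔭`,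
NO `T` (S69 `sum_exp_neg_pinDist_le`). [folklore] -/
theorem locatedSquareBudget_le_torus {𝔭 : Type*} [Fintype 𝔭] (pos : 𝔭 → TPt dT T) {m₀ : ℕ}
    (hm : ∀ x, (Finset.univ.filter fun p => pos p = x).card ≤ m₀) (B₀ : Finset (TPt dT T)) (hB₀ : B₀.Nonempty)
    {δ' : ℝ} (hδ' : 0 < δ') {κc κw d : 𝔭 → ℝ} {κc' κw' d' z β : ℝ} {m : ℕ} (hz : 0 ≤ z) (hκc' : 0 ≤ κc')
    (hd' : 0 ≤ d') (hκc0 : ∀ p, 0 ≤ κc p) (hκw0 : ∀ p, 0 ≤ κw p)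
    (hκc : ∀ p, κc p ≤ κc' * Real.exp (-(δ' * pinDist B₀ hB₀ (pos p))))
    (hκw : ∀ p, κw p ≤ κw' * Real.exp (-(δ' * pinDist B₀ hB₀ (pos p)))) (hd : ∀ p, d p ≤ d') :
    ∑ p, |β| * (d p + (κc p * z + expTail₂ (m * (κw p * z)))) * (κc p * z + expTail₂ (m * (κw p * z))) ≤
      |β| * ((d' + (κc' * z + expTail₂ (m * (κw' * z)))) * (κc' * z + expTail₂ (m * (κw' * z)))) *
        (B₀.card * (m₀ * K₁ dT δ')) := by
  have hS' : 0 ≤ κc' * z + expTail₂ (m * (κw' * z)) := add_nonneg (mul_nonneg hκc' hz) (expTail₂_nonneg _)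
  refine (locatedSquareBudget_le Finset.univ (fun p _ => Real.exp_nonneg _) (fun p _ => ?_) hz hκc' hd'
    (fun p _ => hκc0 p) (fun p _ => hκw0 p) (fun p _ => hκc p) (fun p _ => hκw p) (fun p _ => hd p)).trans
    (mul_le_mul_of_nonneg_left (sum_exp_neg_pinDist_le pos hm B₀ hB₀ hδ') (by positivity))
  rw [Real.exp_le_one_iff, neg_nonpos]
  exact mul_nonneg hδ'.le (ShellMeasurePinnedNorm.pinDist_nonneg B₀ hB₀ _)

end Scalar

/-! ## §2 File 1's chart-ray instance with the letter bounds as binders on the curve -/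

section ChartRay

open scoped Matrix.Norms.L2Operator

variable {nM : Type*} [Fintype nM] [DecidableEq nM] [Nonempty nM]
variable {𝒴 𝒴' 𝒳 𝒵 ℬ : Type*} [NormedAddCommGroup 𝒴] [NormedSpace ℂ 𝒴] [CompleteSpace 𝒴]
  [NormedAddCommGroup 𝒴'] [NormedSpace ℂ 𝒴'] [NormedAddCommGroup 𝒳] [NormedSpace ℂ 𝒳] [CompleteSpace 𝒳]
  [NormedAddCommGroup 𝒵] [NormedSpace ℂ 𝒵] [NormedAddCommGroup ℬ] [NormedSpace ℂ ℬ]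
variable {n : ℕ} {𝒢 : 𝒵 →L[ℂ] 𝒴} {W𝒱 : 𝒴 → 𝒵} {B₀ C₄ a₃ : ℝ}

/-- **END-II's `hE` FOR THE WILSON PART ON THE LD CHAIN'S CHART RAYS, LETTER BOUNDS AS BINDERS ON THE CURVE.**  File 1's
`hE_landau_wilsonSquares` with `κ_w p·‖Y‖`, `κ_c p·‖Y‖` replaced by DISPLAYED per-plaquette bounds ON THE CURVE
`Z_x σ = landauExp … (σ • cplx x)`: `‖ℓ (Z_x σ)‖ ≤ a p` for every letter and `‖Σ_{ℓ∈ℓw p} ℓ (Z_x σ)‖ ≤ s₁ p` (the curl)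
on the disc `‖σ‖ < r_Φ∕S`; budget `Σ_{p∈P_w} |β|(d_p + S_p)S_p ≤ H̄`, `S_p = s₁ p + expTail₂(m_w a p)`.  The chain's
point∕ray binders ((P2) `h𝒢`, (P4) `hW`, (118)∕(121), (103) `hH₁`, (75) `hΦ…`, (44), `hι`, (46), (54)), the real
structure with SKEW weight read-outs and the frozen unitary background plaquettes `B_p` (`‖B_p − 1‖ ≤ d_p`) VERBATIM
from file 1.  CONCLUSION: END-II's `hE` for `𝓔_W y := Σ_{p∈P_w} β(1 − Re tr(B_p·holOf (ℓw p) Z y)∕N)` with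
`B_𝓔 = 3H̄∕(r_Φ∕S − 1)`. [folklore] -/
theorem hE_landau_wilsonSquares_of_discBounds {𝔭 : Type*} {W : Set (Fin n → ℝ)} {Pw : Finset 𝔭} {S : ℝ}
    (hS : 0 < S) (hWS : W ⊆ closedBall (0 : Fin n → ℝ) S)
    (h𝒢 : ∀ f, ‖𝒢 f‖ ≤ B₀ * ‖f‖) (hW : Prop4Hyp W𝒱 C₄ a₃) (hB₀ : 0 < B₀) (hC₄ : 0 ≤ C₄)
    {b ε₄ : ℝ} (hε₄ : 0 ≤ ε₄) (hdom : 2 * (ε₄ + B₀ * b) ≤ a₃)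
    (hself : B₀ * C₄ * (ε₄ + B₀ * b) ^ 2 ≤ ε₄) (hcontr : 4 * B₀ * C₄ * (ε₄ + B₀ * b) < 1)
    (H₁ : ℬ →L[ℂ] 𝒴) (hH₁ : ∀ B, ‖H₁ B‖ ≤ B₀ * ‖B‖)
    {Φ : (Fin n → ℂ) → ℬ} {rΦ : ℝ} (hΦd : DifferentiableOn ℂ Φ (ball 0 rΦ)) (hΦ0 : Φ 0 = 0)
    (hΦ : ∀ z ∈ ball (0 : Fin n → ℂ) rΦ, ‖Φ z‖ < b) (hSr : S < rΦ)
    {C : 𝒴' → 𝒳} {C₂ R : ℝ} (hC₂ : 0 ≤ C₂) (hCq : ∀ Z : 𝒴', ‖Z‖ < R → ‖C Z‖ ≤ C₂ * ‖Z‖ ^ 2)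
    (hCd : DifferentiableOn ℂ C (ball 0 R)) (ι : 𝒴 →L[ℂ] 𝒴') (hι : ∀ Y, ‖ι Y‖ ≤ ‖Y‖) (H : 𝒳 →L[ℂ] 𝒴)
    (hH : ∀ X, ‖H X‖ ≤ B₀ * ‖X‖) (hq : 9 * C₂ * B₀ * (ε₄ + B₀ * b) < 1) (hRC : 3 * (ε₄ + B₀ * b) ≤ R)
    -- weight read-outs, lengths, and the letter ∕ curl bounds ON THE CURVE (DISPLAYED)
    (ℓw : 𝔭 → List (𝒴 →L[ℂ] Matrix nM nM ℂ)) {mw : ℕ} (hlenw : ∀ p ∈ Pw, (ℓw p).length ≤ mw) {a s₁ : 𝔭 → ℝ}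
    (ha0 : ∀ p ∈ Pw, 0 ≤ a p)
    (hZℓ : ∀ x ∈ W, ∀ σ ∈ ball (0 : ℂ) (rΦ / S), ∀ p ∈ Pw, ∀ ℓ ∈ ℓw p,
      ‖ℓ (landauExp C ι H (4 * C₂ * (ε₄ + B₀ * b) ^ 2)
        (solAt 𝒢 0 W𝒱 ε₄ (0 : 𝒵) (H₁ (Φ (σ • cplx x))) + H₁ (Φ (σ • cplx x))))‖ ≤ a p)
    (hZcurl : ∀ x ∈ W, ∀ σ ∈ ball (0 : ℂ) (rΦ / S), ∀ p ∈ Pw,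
      ‖((ℓw p).map fun ℓ => ℓ (landauExp C ι H (4 * C₂ * (ε₄ + B₀ * b) ^ 2)
        (solAt 𝒢 0 W𝒱 ε₄ (0 : 𝒵) (H₁ (Φ (σ • cplx x))) + H₁ (Φ (σ • cplx x))))).sum‖ ≤ s₁ p)
    -- the real structure (chain (A)) with SKEW weight read-outs (chain (E))
    (𝓡𝒴 : AddSubgroup 𝒴) (h𝓡𝒴 : IsClosed (𝓡𝒴 : Set 𝒴)) (𝓡𝒵 : AddSubgroup 𝒵) (𝓡𝒴' : AddSubgroup 𝒴')
    (𝓡𝒳 : AddSubgroup 𝒳) (h𝓡𝒳 : IsClosed (𝓡𝒳 : Set 𝒳)) (𝓡ℬ : AddSubgroup ℬ)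
    (h𝒢r : ∀ f ∈ 𝓡𝒵, 𝒢 f ∈ 𝓡𝒴) (hWr : ∀ Y ∈ 𝓡𝒴, W𝒱 Y ∈ 𝓡𝒵) (hιr : ∀ Y ∈ 𝓡𝒴, ι Y ∈ 𝓡𝒴')
    (hHr : ∀ X ∈ 𝓡𝒳, H X ∈ 𝓡𝒴) (hCr : ∀ Z ∈ 𝓡𝒴', C Z ∈ 𝓡𝒳) (hH₁r : ∀ B ∈ 𝓡ℬ, H₁ B ∈ 𝓡𝒴)
    (hΦr : ∀ y : Fin n → ℝ, ‖y‖ ≤ S → Φ (cplx y) ∈ 𝓡ℬ)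
    (hskew : ∀ p ∈ Pw, ∀ ℓ ∈ ℓw p, ∀ Y ∈ 𝓡𝒴, ℓ Y ∈ skewAdjoint (Matrix nM nM ℂ))
    -- the frozen background plaquettes (N-ne7cp1-g31-2): unitary, `‖B_p − 1‖ ≤ d_p` (DISPLAYED)
    (Bp : 𝔭 → Matrix nM nM ℂ) {d : 𝔭 → ℝ} (hBu : ∀ p ∈ Pw, Bp p ∈ unitary (Matrix nM nM ℂ))
    (hBd : ∀ p ∈ Pw, ‖Bp p - 1‖ ≤ d p)
    -- the budget, second order per plaquette
    {β Hbar : ℝ}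
    (hsum : ∑ p ∈ Pw, |β| * (d p + (s₁ p + expTail₂ (mw * a p))) * (s₁ p + expTail₂ (mw * a p)) ≤ Hbar) :
    ∀ x ∈ W, ∀ c : ℝ, 1 / 2 ≤ c → c ≤ 1 →
      (fun y => ∑ p ∈ Pw, β * (1 - (Matrix.trace (Bp p * holOf (ℓw p) (fun y => landauExp C ι H
        (4 * C₂ * (ε₄ + B₀ * b) ^ 2) (solAt 𝒢 0 W𝒱 ε₄ (0 : 𝒵) (H₁ (Φ (cplx y))) + H₁ (Φ (cplx y)))) y)).re /
          Fintype.card nM)) (c • x) ≤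
      (fun y => ∑ p ∈ Pw, β * (1 - (Matrix.trace (Bp p * holOf (ℓw p) (fun y => landauExp C ι H
        (4 * C₂ * (ε₄ + B₀ * b) ^ 2) (solAt 𝒢 0 W𝒱 ε₄ (0 : 𝒵) (H₁ (Φ (cplx y))) + H₁ (Φ (cplx y)))) y)).re /
          Fintype.card nM)) x +
        (1 - c) * (3 * Hbar / (rΦ / S - 1)) := by
  -- the chain's curve along the chart ray
  set Zc : (Fin n → ℝ) → ℂ → 𝒴 := fun x σ =>
    landauExp C ι H (4 * C₂ * (ε₄ + B₀ * b) ^ 2)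
      (solAt 𝒢 0 W𝒱 ε₄ (0 : 𝒵) (H₁ (Φ (σ • cplx x))) + H₁ (Φ (σ • cplx x))) with hZc
  have hRad1 : 1 < rΦ / S := by rw [lt_div_iff₀ hS]; linarith
  have hRad : 0 < rΦ / S := one_pos.trans hRad1
  have hb : 0 < b := (norm_nonneg _).trans_lt (hΦ 0 (mem_ball_self (hS.trans hSr)))
  have ha : 0 < B₀ * b := mul_pos hB₀ hb
  have hΛ : ∀ Y : 𝒴, ‖(0 : 𝒴 →L[ℂ] 𝒴) Y‖ ≤ 0 * ‖Y‖ := fun Y => by simp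
  have hself' : B₀ * 0 + 0 * (ε₄ + B₀ * b) + B₀ * C₄ * (ε₄ + B₀ * b) ^ 2 ≤ ε₄ := by simpa using hself
  have hcontr' : 0 + 4 * B₀ * C₄ * (ε₄ + B₀ * b) < 1 := by simpa using hcontr
  have hray := fun x (hx : x ∈ W) =>
    rayData_chart H₁ hH₁ hB₀ hΦd hΦ0 hΦ hS (mem_closedBall_zero_iff.1 (hWS hx))
  have hcurve : ∀ x ∈ W, DifferentiableOn ℂ (Zc x) (ball 0 (rΦ / S)) := fun x hx =>
    (landauCurve_along h𝒢 hΛ hW hB₀.le hC₄ le_rfl hε₄ hdom hself' hcontr' hRad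
      (currentData_zero (𝒵 := 𝒵) (rΦ / S)).1 (hray x hx).1 (currentData_zero (𝒵 := 𝒵) (rΦ / S)).2.1
      (hray x hx).2.2.1 rfl (hray x hx).2.1 hC₂ hCq hCd ι hι H hH hq hRC).1
  -- the flat centre: `Zc x 0 = 0`
  have hε4a : 0 < ε₄ + B₀ * b := by linarith
  have hZ0 : ∀ x, Zc x 0 = 0 := fun x => by
    simp only [hZc, zero_smul, hΦ0, map_zero]
    rw [solAt_zero_zero h𝒢 hΛ hW hB₀.le hC₄ le_rfl hε₄ ha hdom hself' hcontr', zero_add]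
    exact landauExp_zero hC₂ hCq hCd hι hB₀.le hH hq hRC hε4a
  -- real chart points of the window: the exponent field is real, the weight letters skew
  have hreal : ∀ x ∈ W, ∀ c : ℝ, 0 ≤ c → c ≤ 1 → ∀ p ∈ Pw, ∀ ℓ ∈ ℓw p,
      ℓ (Zc x (c : ℂ)) ∈ skewAdjoint (Matrix nM nM ℂ) := by
    intro x hx c hc0 hc1 p hp ℓ hℓ
    have hy : ‖c • x‖ ≤ S := by
      rw [norm_smul, Real.norm_of_nonneg hc0]
      exact (mul_le_of_le_one_left (norm_nonneg _) hc1).trans (mem_closedBall_zero_iff.1 (hWS hx))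
    have hmem := landauField_mem_real h𝒢 hW hB₀ hC₄ hε₄ hdom hself hcontr H₁ hH₁ hΦ hSr hC₂ hCq hCd ι hι H hH hq hRC
      𝓡𝒴 h𝓡𝒴 𝓡𝒵 𝓡𝒴' 𝓡𝒳 h𝓡𝒳 𝓡ℬ h𝒢r hWr hιr hHr hCr hH₁r hΦr hy
    have e : Zc x (c : ℂ) = landauExp C ι H (4 * C₂ * (ε₄ + B₀ * b) ^ 2)
        (solAt 𝒢 0 W𝒱 ε₄ (0 : 𝒵) (H₁ (Φ (cplx (c • x)))) + H₁ (Φ (cplx (c • x)))) := by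
      simp only [hZc, ofReal_smul_cplx]
    rw [e]
    exact hskew p hp ℓ hℓ _ hmem
  -- file 1's §3 on the letter curves `σ ↦ ℓ (Zc x σ)`
  refine hE_of_wilsonPlaquettes (fun _ => Pw) (fun _ p => Bp p) (fun x p => (ℓw p).map fun ℓ => fun σ => ℓ (Zc x σ))
    (R := rΦ / S) (β := β) (Hbar := Hbar) (d := fun _ p => d p) (a := fun _ p => a p)
    (s₁ := fun _ p => s₁ p) (m := mw) hRad1 (fun x _ p hp => hBu p hp) (fun x _ p hp => hBd p hp)
    (fun x _ p hp => by simpa using hlenw p hp) (fun x hx p hp X hX => ?_) (fun x hx p hp X hX => ?_)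
    (fun x _ p hp => ha0 p hp) (fun x hx p hp X hX w hw => ?_) (fun x hx p hp w hw => ?_)
    (fun x hx p hp c hc0 hc1 X hX => ?_) (fun x _ => hsum)
    (𝓔 := fun y => ∑ p ∈ Pw, β * (1 - (Matrix.trace (Bp p * holOf (ℓw p) (fun y => landauExp C ι H
        (4 * C₂ * (ε₄ + B₀ * b) ^ 2) (solAt 𝒢 0 W𝒱 ε₄ (0 : 𝒵) (H₁ (Φ (cplx y))) + H₁ (Φ (cplx y)))) y)).re /
          Fintype.card nM))
    (fun x hx c hc0 hc1 => ?_)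
  · -- holomorphy of a letter curve
    obtain ⟨ℓ, -, rfl⟩ := List.mem_map.1 hX
    exact ℓ.differentiable.comp_differentiableOn (hcurve x hx)
  · -- vanishing at the flat centre
    obtain ⟨ℓ, -, rfl⟩ := List.mem_map.1 hX
    simp [hZ0 x]
  · -- per-letter bound (the binder on the curve)
    obtain ⟨ℓ, hℓ, rfl⟩ := List.mem_map.1 hX
    exact hZℓ x hx w hw p hp ℓ hℓ
  · -- the curl bound (the binder on the curve)
    have e : ((((ℓw p).map fun ℓ => fun σ => ℓ (Zc x σ)).map fun X => X w)) = (ℓw p).map fun ℓ => ℓ (Zc x w) := by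
      rw [List.map_map]; rfl
    rw [e]
    exact hZcurl x hx w hw p hp
  · -- skew letters on the real segment
    obtain ⟨ℓ, hℓ, rfl⟩ := List.mem_map.1 hX
    exact hreal x hx c hc0 hc1 p hp ℓ hℓ
  · -- the dictionary
    refine Finset.sum_congr rfl fun p _ => ?_
    have e : ((((ℓw p).map fun ℓ => fun σ => ℓ (Zc x σ)).map fun X => X (c : ℂ)).map exp).prod =
        holOf (ℓw p) (fun y => landauExp C ι H (4 * C₂ * (ε₄ + B₀ * b) ^ 2)
          (solAt 𝒢 0 W𝒱 ε₄ (0 : 𝒵) (H₁ (Φ (cplx y))) + H₁ (Φ (cplx y)))) (c • x) := by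
      simp only [holOf_apply, wordExp, List.map_map, Function.comp_def, hZc, ofReal_smul_cplx]
    rw [e]

/-! ## §3 The pinned instance: letter bounds through the reading `π𝒴` and leaf-07's `z_pin` -/

variable {P𝒴 P𝒴' P𝒳 Pℬ : Type*} [NormedAddCommGroup P𝒴] [NormedSpace ℂ P𝒴] [NormedAddCommGroup P𝒴']
  [NormedSpace ℂ P𝒴'] [NormedAddCommGroup P𝒳] [NormedSpace ℂ P𝒳] [NormedAddCommGroup Pℬ] [NormedSpace ℂ Pℬ]

/-- **END-II's `hE` FOR THE FAR (AND NEAR) WEIGHT PLAQUETTES, PINNED.**  Data: §2's flat chain binders; a reading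
`π𝒴, π𝒴′, π𝒳, πℬ` of the chain's spaces (S69's `WSup (pinW δ′ ϖ)`, DISPLAYED as maps) with leaf-07-g6's PINNED chain
binders VERBATIM (`hGWp` with `q_W < 1`, `hCp`, `hιp`, `hHp` with `k = L_C c_ι B_H < 1`, `hH₁p`, `hΦp` on the chart
ball);
PINNED read-out binders `‖ℓ Y‖ ≤ κ_w p·‖π𝒴 Y‖` (each letter of `ℓw p`) and `‖Σ_{ℓ∈ℓw p} ℓ Y‖ ≤ κ_c p·‖π𝒴 Y‖` (the curl)
— S69 (B) `norm_readOut_le_of_blind`'s output shape, `κ p = ‖ℓ‖e^{−δ′ϖ(p)}` for a read-out blind off pin depth `ϖ(p)`;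
budget `Σ_{p∈P_w} |β|(d_p + S_p)S_p ≤ H̄` with `S_p = κ_c p·z_pin + expTail₂(m_w κ_w p z_pin)`,
**`z_pin = B₁ₚbₚ∕((1 − q_W)(1 − L_C c_ι B_H))`** (leaf-07's S70 (iv)).  CONCLUSION: END-II's `hE` for the Wilson ray
profile
`𝓔_W` with `B_𝓔 = 3H̄∕(r_Φ∕S − 1)` — §2 with `a p = κ_w p·z_pin`, `s₁ p = κ_c p·z_pin`, the curve's pinned size from
`ShellMeasureLandauPinnedField.norm_sub_landauField_chart_le` BY NAME on the complex chart ray (`smul_cplx_mem_ball`).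
The located `H̄` is §4. [folklore] -/
theorem hE_landau_wilsonSquares_pinned {𝔭 : Type*} {W : Set (Fin n → ℝ)} {Pw : Finset 𝔭} {S : ℝ}
    (hS : 0 < S) (hWS : W ⊆ closedBall (0 : Fin n → ℝ) S)
    (h𝒢 : ∀ f, ‖𝒢 f‖ ≤ B₀ * ‖f‖) (hW : Prop4Hyp W𝒱 C₄ a₃) (hB₀ : 0 < B₀) (hC₄ : 0 ≤ C₄)
    {b ε₄ : ℝ} (hε₄ : 0 ≤ ε₄) (hdom : 2 * (ε₄ + B₀ * b) ≤ a₃)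
    (hself : B₀ * C₄ * (ε₄ + B₀ * b) ^ 2 ≤ ε₄) (hcontr : 4 * B₀ * C₄ * (ε₄ + B₀ * b) < 1)
    (H₁ : ℬ →L[ℂ] 𝒴) (hH₁ : ∀ B, ‖H₁ B‖ ≤ B₀ * ‖B‖)
    {Φ : (Fin n → ℂ) → ℬ} {rΦ : ℝ} (hΦd : DifferentiableOn ℂ Φ (ball 0 rΦ)) (hΦ0 : Φ 0 = 0)
    (hΦ : ∀ z ∈ ball (0 : Fin n → ℂ) rΦ, ‖Φ z‖ < b) (hSr : S < rΦ)
    {C : 𝒴' → 𝒳} {C₂ R : ℝ} (hC₂ : 0 ≤ C₂) (hCq : ∀ Z : 𝒴', ‖Z‖ < R → ‖C Z‖ ≤ C₂ * ‖Z‖ ^ 2)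
    (hCd : DifferentiableOn ℂ C (ball 0 R)) (ι : 𝒴 →L[ℂ] 𝒴') (hι : ∀ Y, ‖ι Y‖ ≤ ‖Y‖) (H : 𝒳 →L[ℂ] 𝒴)
    (hH : ∀ X, ‖H X‖ ≤ B₀ * ‖X‖) (hq : 9 * C₂ * B₀ * (ε₄ + B₀ * b) < 1) (hRC : 3 * (ε₄ + B₀ * b) ≤ R)
    -- the reading and leaf-07's pinned chain binders (DISPLAYED)
    (π𝒴 : 𝒴 →L[ℂ] P𝒴) (π𝒴' : 𝒴' →L[ℂ] P𝒴') (π𝒳 : 𝒳 →L[ℂ] P𝒳) (πℬ : ℬ →L[ℂ] Pℬ) {qW LC cι BH B₁p bp : ℝ}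
    (hGWp : ∀ Y Y', ‖Y‖ < ε₄ + B₀ * b → ‖Y'‖ < ε₄ + B₀ * b →
      ‖π𝒴 (𝒢 (W𝒱 Y)) - π𝒴 (𝒢 (W𝒱 Y'))‖ ≤ qW * ‖π𝒴 Y - π𝒴 Y'‖) (hqW : qW < 1)
    (hCp : ∀ A A' : 𝒴', ‖A‖ < R → ‖A'‖ < R → ‖π𝒳 (C A) - π𝒳 (C A')‖ ≤ LC * ‖π𝒴' A - π𝒴' A'‖)
    (hιp : ∀ Y, ‖π𝒴' (ι Y)‖ ≤ cι * ‖π𝒴 Y‖) (hHp : ∀ X, ‖π𝒴 (H X)‖ ≤ BH * ‖π𝒳 X‖)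
    (hLC : 0 ≤ LC) (hcι : 0 ≤ cι) (hBH : 0 ≤ BH) (hk : LC * cι * BH < 1)
    (hB₁p : 0 ≤ B₁p) (hH₁p : ∀ B, ‖π𝒴 (H₁ B)‖ ≤ B₁p * ‖πℬ B‖)
    (hΦp : ∀ z ∈ ball (0 : Fin n → ℂ) rΦ, ‖πℬ (Φ z)‖ ≤ bp) (hbp : 0 ≤ bp)
    -- weight read-outs with PINNED letter ∕ curl constants (S69 (B)'s output shape, DISPLAYED), lengths
    (ℓw : 𝔭 → List (𝒴 →L[ℂ] Matrix nM nM ℂ)) {κw κc : 𝔭 → ℝ} (hκw : ∀ p ∈ Pw, 0 ≤ κw p)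
    (hκc : ∀ p ∈ Pw, 0 ≤ κc p)
    (hℓwπ : ∀ p ∈ Pw, ∀ ℓ ∈ ℓw p, ∀ Y, ‖ℓ Y‖ ≤ κw p * ‖π𝒴 Y‖)
    (hcurlπ : ∀ p ∈ Pw, ∀ Y, ‖((ℓw p).map fun ℓ => ℓ Y).sum‖ ≤ κc p * ‖π𝒴 Y‖)
    {mw : ℕ} (hlenw : ∀ p ∈ Pw, (ℓw p).length ≤ mw)
    -- the real structure (chain (A)) with SKEW weight read-outs (chain (E))
    (𝓡𝒴 : AddSubgroup 𝒴) (h𝓡𝒴 : IsClosed (𝓡𝒴 : Set 𝒴)) (𝓡𝒵 : AddSubgroup 𝒵) (𝓡𝒴' : AddSubgroup 𝒴')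
    (𝓡𝒳 : AddSubgroup 𝒳) (h𝓡𝒳 : IsClosed (𝓡𝒳 : Set 𝒳)) (𝓡ℬ : AddSubgroup ℬ)
    (h𝒢r : ∀ f ∈ 𝓡𝒵, 𝒢 f ∈ 𝓡𝒴) (hWr : ∀ Y ∈ 𝓡𝒴, W𝒱 Y ∈ 𝓡𝒵) (hιr : ∀ Y ∈ 𝓡𝒴, ι Y ∈ 𝓡𝒴')
    (hHr : ∀ X ∈ 𝓡𝒳, H X ∈ 𝓡𝒴) (hCr : ∀ Z ∈ 𝓡𝒴', C Z ∈ 𝓡𝒳) (hH₁r : ∀ B ∈ 𝓡ℬ, H₁ B ∈ 𝓡𝒴)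
    (hΦr : ∀ y : Fin n → ℝ, ‖y‖ ≤ S → Φ (cplx y) ∈ 𝓡ℬ)
    (hskew : ∀ p ∈ Pw, ∀ ℓ ∈ ℓw p, ∀ Y ∈ 𝓡𝒴, ℓ Y ∈ skewAdjoint (Matrix nM nM ℂ))
    -- the frozen background plaquettes (N-ne7cp1-g31-2)
    (Bp : 𝔭 → Matrix nM nM ℂ) {d : 𝔭 → ℝ} (hBu : ∀ p ∈ Pw, Bp p ∈ unitary (Matrix nM nM ℂ))
    (hBd : ∀ p ∈ Pw, ‖Bp p - 1‖ ≤ d p)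
    -- the budget, second order per plaquette, in `z_pin`
    {β Hbar : ℝ}
    (hsum : ∑ p ∈ Pw, |β| * (d p + (κc p * (B₁p * bp / ((1 - qW) * (1 - LC * cι * BH))) +
        expTail₂ (mw * (κw p * (B₁p * bp / ((1 - qW) * (1 - LC * cι * BH))))))) *
      (κc p * (B₁p * bp / ((1 - qW) * (1 - LC * cι * BH))) +
        expTail₂ (mw * (κw p * (B₁p * bp / ((1 - qW) * (1 - LC * cι * BH)))))) ≤ Hbar) :
    ∀ x ∈ W, ∀ c : ℝ, 1 / 2 ≤ c → c ≤ 1 →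
      (fun y => ∑ p ∈ Pw, β * (1 - (Matrix.trace (Bp p * holOf (ℓw p) (fun y => landauExp C ι H
        (4 * C₂ * (ε₄ + B₀ * b) ^ 2) (solAt 𝒢 0 W𝒱 ε₄ (0 : 𝒵) (H₁ (Φ (cplx y))) + H₁ (Φ (cplx y)))) y)).re /
          Fintype.card nM)) (c • x) ≤
      (fun y => ∑ p ∈ Pw, β * (1 - (Matrix.trace (Bp p * holOf (ℓw p) (fun y => landauExp C ι H
        (4 * C₂ * (ε₄ + B₀ * b) ^ 2) (solAt 𝒢 0 W𝒱 ε₄ (0 : 𝒵) (H₁ (Φ (cplx y))) + H₁ (Φ (cplx y)))) y)).re /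
          Fintype.card nM)) x +
        (1 - c) * (3 * Hbar / (rΦ / S - 1)) := by
  set zpin : ℝ := B₁p * bp / ((1 - qW) * (1 - LC * cι * BH)) with hzpin
  have hk1 : 0 < 1 - LC * cι * BH := by linarith
  have hs1 : 0 < 1 - qW := by linarith
  have hz : 0 ≤ zpin := div_nonneg (mul_nonneg hB₁p hbp) (mul_pos hs1 hk1).le
  -- the pinned size of the field on the complex chart ray (leaf-07's S70 (iv))
  have hZπ : ∀ x ∈ W, ∀ σ ∈ ball (0 : ℂ) (rΦ / S),
      ‖π𝒴 (landauExp C ι H (4 * C₂ * (ε₄ + B₀ * b) ^ 2)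
        (solAt 𝒢 0 W𝒱 ε₄ (0 : 𝒵) (H₁ (Φ (σ • cplx x))) + H₁ (Φ (σ • cplx x))))‖ ≤ zpin := fun x hx σ hσ =>
    (norm_sub_landauField_chart_le π𝒴 π𝒴' π𝒳 πℬ h𝒢 hW hB₀ hC₄ hε₄ hdom hself hcontr hH₁ hΦ0 hΦ hC₂ hCq hCd hι hH
      hq hRC hGWp hqW hCp hιp hHp hLC hcι hBH hk hB₁p hH₁p hΦp
      (smul_cplx_mem_ball hS (mem_closedBall_zero_iff.1 (hWS hx)) hσ)).2
  refine hE_landau_wilsonSquares_of_discBounds hS hWS h𝒢 hW hB₀ hC₄ hε₄ hdom hself hcontr H₁ hH₁ hΦd hΦ0 hΦ hSr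
    hC₂ hCq hCd ι hι H hH hq hRC ℓw hlenw (a := fun p => κw p * zpin) (s₁ := fun p => κc p * zpin)
    (fun p hp => mul_nonneg (hκw p hp) hz) (fun x hx σ hσ p hp ℓ hℓ => ?_) (fun x hx σ hσ p hp => ?_)
    𝓡𝒴 h𝓡𝒴 𝓡𝒵 𝓡𝒴' 𝓡𝒳 h𝓡𝒳 𝓡ℬ h𝒢r hWr hιr hHr hCr hH₁r hΦr hskew Bp hBu hBd (by simpa [hzpin] using hsum)
  · exact (hℓwπ p hp ℓ hℓ _).trans (mul_le_mul_of_nonneg_left (hZπ x hx σ hσ) (hκw p hp))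
  · exact (hcurlπ p hp _).trans (mul_le_mul_of_nonneg_left (hZπ x hx σ hσ) (hκc p hp))

end ChartRay

/-! ## §4 The budget binder of §3 from located constants -/

section Budget

/-- **THE BUDGET OF §3, LOCATED**: with `κ_c p ≤ κ̄_c e_p`, `κ_w p ≤ κ̄_w e_p`, `d_p ≤ d̄`, `0 ≤ e_p ≤ 1` and
`Σ_{p∈P_w} e_p ≤ K` (on the torus `K = #B₀·m₀·K₁ d δ′`: S69 `sum_exp_neg_pinDist_le`, §1 `locatedSquareBudget_le_torus`
for `P_w = univ`), any `H̄ ≥ |β|(d̄ + S̄)S̄·K`, `S̄ = κ̄_c z + expTail₂(m_w κ̄_w z)`, is a budget for §3 (`z = z_pin`) —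
NO `#P_w`, NO volume. [folklore] -/
theorem hsum_of_located {𝔭 : Type*} (Pw : Finset 𝔭) {κc κw d e : 𝔭 → ℝ} {κc' κw' d' z β K Hbar : ℝ} {mw : ℕ}
    (he0 : ∀ p ∈ Pw, 0 ≤ e p) (he1 : ∀ p ∈ Pw, e p ≤ 1) (hz : 0 ≤ z) (hκc' : 0 ≤ κc') (hd' : 0 ≤ d')
    (hκc0 : ∀ p ∈ Pw, 0 ≤ κc p) (hκw0 : ∀ p ∈ Pw, 0 ≤ κw p)
    (hκc : ∀ p ∈ Pw, κc p ≤ κc' * e p) (hκw : ∀ p ∈ Pw, κw p ≤ κw' * e p) (hd : ∀ p ∈ Pw, d p ≤ d')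
    (hK : ∑ p ∈ Pw, e p ≤ K)
    (hH : |β| * ((d' + (κc' * z + expTail₂ (mw * (κw' * z)))) * (κc' * z + expTail₂ (mw * (κw' * z)))) * K ≤ Hbar) :
    ∑ p ∈ Pw, |β| * (d p + (κc p * z + expTail₂ (mw * (κw p * z)))) * (κc p * z + expTail₂ (mw * (κw p * z))) ≤
      Hbar := by
  have hS' : 0 ≤ κc' * z + expTail₂ (mw * (κw' * z)) := add_nonneg (mul_nonneg hκc' hz) (expTail₂_nonneg _)
  exact (locatedSquareBudget_le Pw he0 he1 hz hκc' hd' hκc0 hκw0 hκc hκw hd).trans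
    ((mul_le_mul_of_nonneg_left hK (by positivity)).trans hH)

end Budget

/-! ## §5 (v1.1, APPEND-ONLY) η AT THE LIVE LEVEL — the display owner note N-ne7cp1-g31-3 asks for
The number of `locatedSquareBudget_le_torus` is `|β|(d̄ + S̄)S̄·(#B₀·m₀·K₁ d δ′)`.  η-FREE reading (WALL §2b `B_W`):
per FINE plaquette `(d̄ + S̄)S̄ ∝ η⁴` (`κ̄_c z, d̄ ∝ η²`, `κ̄_w z ∝ η`; S72 `squareBudget_le`), plaquettes PLACED AT
UNIT-LATTICE SITES (`pos p` the unit site of `p`, `m₀ ∝ η^{−4}` fine plaquettes per unit site, `pinDist`, `δ′`, `K₁`,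
`#B₀` in unit-lattice terms) ⟹ `m₀(d̄ + S̄)S̄` and the whole number η-free.  `pos` at FINE sites (`m₀ = O(1)`,
`#B₀ ∝ η^{−4}`, rate `δ′η`) is off by `η^{−4}` — N-3's warning.  The `example` is that arithmetic, nothing more. -/
/-- η-DISPLAY (N-ne7cp1-g31-3): per-plaquette square data `d̄ = d₀η²`, `S̄ = s₀η²`, unit-site multiplicity `m₀ = μ∕η⁴`
⟹ the located budget `|β|(d̄ + S̄)S̄·(#B₀·m₀·K)` IS the η-free number `|β|(d₀ + s₀)s₀·(#B₀·μ·K)`. [folklore] -/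
example (β d₀ s₀ μ B K η : ℝ) (hη : η ≠ 0) :
    |β| * ((d₀ * η ^ 2 + s₀ * η ^ 2) * (s₀ * η ^ 2)) * (B * (μ / η ^ 4 * K)) =
      |β| * ((d₀ + s₀) * s₀) * (B * (μ * K)) := by
  field_simp

end Summit.QuantumFields.BalabanUV.T4Continuum.ShellMeasureLandauWilsonSquaresPinned

end
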